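import Literature.NumberTheory.Automorphic.GodementJacquetLocalConvergenceProofs
import Literature.NumberTheory.Automorphic.CongruenceSubgroupExpansionGL
import Literature.NumberTheory.Automorphic.CongruenceSubgroupGL
import HarnessLib

/-!
# Right-`GL_n(𝒪)`-invariant Schwartz–Bruhat functions on `M_n(F)` restricted to `GL_n(F)` are
finite combinations of the indicators `1_{z M_n(𝒪)}`

Topic `NumberTheory/Automorphic`; theorems only (no definition, no named fact). Support file for
the discharge of `GodementJacquet1972_hasGJLFactor_of_isSatakeParameter` (`GodementJacquetLocal`:
the unramified local `L`-factor `L(s, π) = ∏ (1 - α_i q^{-s})⁻¹` of Godement–Jacquet, LNM 260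
(1972), Lemma 6.10 with Thm. 3.3). Setting: `F` a non-archimedean local field, `𝒪 = 𝒪_F`, `ϖ` a
uniformizing element, `K = GL_n(𝒪) = glInt n F`, `M = M_n(𝒪)` (`intMatrices`, `IsIntegralMatrix`).

* `exists_eq_sum_mul_ite_of_rel` (**Möbius inversion on a finite poset**, in the form used):
  for a reflexive, transitive, antisymmetric relation `≼` on a finite type, every function is a
  linear combination of the "principal down-set" indicators `x ↦ [x ≼ p]` (the zeta matrix is
  unitriangular).
* `exists_forall_add_eq_of_mem_schwartzBruhat`, `exists_forall_add_smul_eq_of_mem_schwartzBruhat`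
  (**uniform local constancy**): a Schwartz–Bruhat `Φ` on `M_n(F)` satisfies
  `Φ(x + ϖ^N y) = Φ(x)` for all `x` and all integral `y`, for some `N`.
* `exists_forall_mul_congruenceGL_eq_of_mem_schwartzBruhat`: hence `Φ(x k) = Φ(x) = Φ(k x)` for
  `k` in a principal congruence subgroup `K_m = 1 + ϖ^m M_n(𝒪)`.
* `exists_eq_sum_indicator_intMatrices_of_mem_schwartzBruhat` (**the lattice expansion**): if
  `Φ` is Schwartz–Bruhat and `Φ(x k) = Φ(x)` for `k ∈ K`, there are finitely many `c_i ∈ ℂ`,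
  `z_i ∈ GL_n(F)` with `Φ(x) = ∑_i c_i 1_{M}(z_i⁻¹ x)` for **every `x ∈ GL_n(F)`** (not on all of
  `M_n(F)`: for `n = 1`, `1_{𝒪^×} = 1_{𝒪} - 1_{ϖ𝒪}` off `0`). Proof: choose `N` with
  `supp Φ ⊆ ϖ^{-N} M` and `Φ(x + ϖ^N y) = Φ(x)` (`y ∈ M`). For `x ∈ GL_n(F)` the value `Φ(x)`
  and the truth of `z⁻¹ x ∈ M` (for `ϖ^N z⁻¹ ∈ M`) only depend on the lattice
  `x 𝒪^n + ϖ^N 𝒪^n`, which by the Cartan decomposition `x = k₁⁻¹ ϖ^a k₂⁻¹` is `y 𝒪^n`,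
  `y = k₁⁻¹ ϖ^{min(a, N)}` (`Φ(x) = Φ(k₁⁻¹ ϖ^a) = Φ(y)` as `y - k₁⁻¹ ϖ^a ∈ ϖ^N M`;
  `z⁻¹ x ∈ M ↔ z⁻¹ y ∈ M`); the cosets `y K` with `ϖ^N y^{±1} ∈ M` form a finite poset under
  `y ≼ y' ↔ y'⁻¹ y ∈ M` (finitely many cosets in each `Δ_m`, `finite_cosets_glIntDet`), on which
  `[y ≼ y'] = 1_M(y'⁻¹ y)`, and Möbius inversion expresses `y ↦ Φ(y)` through these indicators.

This is the combinatorial input of the identification of the unramified `L`-factor through the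
zeta integrals `Z(1_{zM}, s, ω°) = |det z|^s ω°(z) Z(1_M, s, ω°)` of the zonal spherical function
(`GodementJacquetSphericalZeta`), replacing the printed route through the unramified principal
series (Godement–Jacquet (1972), §3, §6; Jacquet (1979), §1, §3).

## References

* R. Godement, H. Jacquet, *Zeta functions of simple algebras*, LNM 260 (1972), §6, Lemma 6.10
  and Thm. 3.3 [GodementJacquet1972] (not held; statements as recorded in `GodementJacquetLocal`).
* G. Shimura, *Introduction to the arithmetic theory of automorphic functions* (1971), §3.2
  (lattices and the cosets `GL_n(𝒪) \ Δ`) [ShimuraIATAF1971].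
* G.-C. Rota, *On the foundations of combinatorial theory I: theory of Möbius functions*,
  Z. Wahrscheinlichkeitstheorie 2 (1964), §3 (Möbius inversion on locally finite posets).
-/

set_option autoImplicit false

noncomputable section

open scoped MatrixGroups
open Matrix ValuativeRel

namespace Literature.NumberTheory.Automorphic

/-! ### Möbius inversion on a finite poset (zeta basis) -/

section Moebius

/-- **The principal down-set indicators span all functions on a finite poset** (unitriangularity
of the zeta matrix; Möbius inversion, Rota (1964), §3). For a reflexive, transitive and
antisymmetric relation `r` on a finite type `P` and any `f : P → k`, there are coefficients
`m : P → k` with `f x = ∑_p m p · [r x p]` for all `x`. Proof: the point mass at `p` is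
`[· ≼ p] - ∑_{x ≺ p} δ_x`, by induction on the size of the strict down-set of `p`. [folklore] -/
theorem exists_eq_sum_mul_ite_of_rel {k : Type*} [CommRing k] {P : Type*} [Fintype P]
    (r : P → P → Prop) [DecidableRel r] (hrefl : ∀ x, r x x)
    (htrans : ∀ x y z, r x y → r y z → r x z) (hanti : ∀ x y, r x y → r y x → x = y) (f : P → k) :
    ∃ m : P → k, ∀ x, f x = ∑ p, m p * (if r x p then 1 else 0) := by
  classical
  -- the indicators `ζ p = [· ≼ p]`, the point masses `δ p`, and the span `W` of the `ζ p`
  set ζ : P → P → k := fun p x => if r x p then 1 else 0 with hζ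
  set δ : P → P → k := fun p x => if x = p then 1 else 0 with hδ
  set W : Submodule k (P → k) := Submodule.span k (Set.range ζ) with hW
  -- strict down-sets
  set D : P → Finset P := fun p => Finset.univ.filter fun x => r x p ∧ x ≠ p with hD
  have hDsub : ∀ {x p}, x ∈ D p → D x ⊂ D p := by
    intro x p hx
    rw [hD, Finset.mem_filter] at hx
    refine Finset.ssubset_iff_subset_ne.mpr ⟨fun y hy => ?_, fun h => ?_⟩
    · rw [hD, Finset.mem_filter] at hy ⊢
      refine ⟨Finset.mem_univ _, htrans _ _ _ hy.2.1 hx.2.1, fun hyp => ?_⟩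
      rw [hyp] at hy
      exact hx.2.2 (hanti _ _ hx.2.1 hy.2.1)
    · have hxx : x ∈ D x := by rw [h]; exact Finset.mem_filter.mpr ⟨Finset.mem_univ _, hx.2⟩
      rw [hD, Finset.mem_filter] at hxx
      exact hxx.2.2 rfl
  -- `ζ p = δ p + ∑_{x ∈ D p} δ x`
  have hζδ : ∀ p, ζ p = δ p + ∑ x ∈ D p, δ x := by
    intro p
    funext y
    simp only [hζ, hδ, Pi.add_apply, Finset.sum_apply]
    by_cases hyp : y = p
    · subst hyp
      rw [if_pos (hrefl y), if_pos rfl, Finset.sum_eq_zero (fun x hx => ?_), add_zero]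
      rw [hD, Finset.mem_filter] at hx
      rw [if_neg (Ne.symm hx.2.2)]
    · rw [if_neg hyp, zero_add]
      by_cases hr : r y p
      · rw [if_pos hr, Finset.sum_eq_single y (fun x _ hxy => if_neg (Ne.symm hxy)) (fun h => ?_),
          if_pos rfl]
        exact absurd (Finset.mem_filter.mpr ⟨Finset.mem_univ _, hr, hyp⟩) h
      · rw [if_neg hr, Finset.sum_eq_zero (fun x hx => ?_)]
        rw [hD, Finset.mem_filter] at hx
        rw [if_neg]
        rintro rfl
        exact hr hx.2.1
  -- every point mass lies in `W`, by induction on `#(D p)`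
  have hδW : ∀ (N : ℕ) (p : P), (D p).card ≤ N → δ p ∈ W := by
    intro N
    induction N with
    | zero =>
      intro p hp
      have hDp : D p = ∅ := Finset.card_eq_zero.mp (Nat.le_zero.mp hp)
      have : δ p = ζ p := by rw [hζδ p, hDp, Finset.sum_empty, add_zero]
      rw [this]
      exact Submodule.subset_span ⟨p, rfl⟩
    | succ N ih =>
      intro p hp
      have e : δ p = ζ p - ∑ x ∈ D p, δ x := by rw [hζδ p]; abel
      rw [e]
      refine Submodule.sub_mem _ (Submodule.subset_span ⟨p, rfl⟩)
        (Submodule.sum_mem _ fun x hx => ih x ?_)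
      have := Finset.card_lt_card (hDsub hx)
      omega
  -- hence `f = ∑_p f p • δ p` lies in `W`
  have hf : f ∈ W := by
    have e : f = ∑ p, f p • δ p := by
      funext y
      simp only [Finset.sum_apply, Pi.smul_apply, hδ, smul_eq_mul, mul_ite, mul_one, mul_zero]
      rw [Finset.sum_ite_eq Finset.univ y (fun p => f p)]
      simp
    rw [e]
    exact Submodule.sum_mem _ fun p _ => Submodule.smul_mem _ _ (hδW _ p le_rfl)
  rw [hW] at hf
  obtain ⟨c, hc⟩ := (Submodule.mem_span_range_iff_exists_fun k).mp hf
  refine ⟨c, fun x => ?_⟩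
  have := congrFun hc x
  simp only [Finset.sum_apply, Pi.smul_apply, smul_eq_mul] at this
  rw [← this]

end Moebius

/-! ### Uniform local constancy of Schwartz–Bruhat functions on `M_n(F)` -/

section LocallyConstant

open _root_.Topology Filter

variable {F : Type*} [Field F] [ValuativeRel F] {n : ℕ}

omit [ValuativeRel F] in
/-- Sums of integral matrices are integral. [folklore] -/
theorem IsIntegralMatrix.add [ValuativeRel F] {M N : Matrix (Fin n) (Fin n) F}
    (hM : IsIntegralMatrix M) (hN : IsIntegralMatrix N) : IsIntegralMatrix (M + N) := fun i j => by
  rw [Matrix.add_apply]; exact add_mem (hM i j) (hN i j)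

/-- Negatives of integral matrices are integral. [folklore] -/
theorem IsIntegralMatrix.neg {M : Matrix (Fin n) (Fin n) F} (hM : IsIntegralMatrix M) :
    IsIntegralMatrix (-M) := fun i j => by
  rw [Matrix.neg_apply]; exact neg_mem (hM i j)

/-- `0` is an integral matrix. [folklore] -/
theorem IsIntegralMatrix.zero : IsIntegralMatrix (0 : Matrix (Fin n) (Fin n) F) := fun i j => by
  rw [Matrix.zero_apply]; exact zero_mem _

/-- Integral scalar multiples of integral matrices are integral. [folklore] -/
theorem IsIntegralMatrix.smul {M : Matrix (Fin n) (Fin n) F} (hM : IsIntegralMatrix M) {c : F}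
    (hc : c ∈ 𝒪[F]) : IsIntegralMatrix (c • M) := fun i j => by
  rw [Matrix.smul_apply, smul_eq_mul]; exact mul_mem hc (hM i j)

/-- Diagonal matrices with integral entries are integral. [folklore] -/
theorem isIntegralMatrix_diagonal {d : Fin n → F} (hd : ∀ i, d i ∈ 𝒪[F]) :
    IsIntegralMatrix (Matrix.diagonal d) := fun i j => by
  by_cases h : i = j
  · subst h; rw [Matrix.diagonal_apply_eq]; exact hd i
  · rw [Matrix.diagonal_apply_ne _ h]; exact zero_mem _

variable [TopologicalSpace F] [IsNonarchimedeanLocalField F]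

/-- The integral matrices form an open subset of `M_n(F)` (finitely many open coordinate
conditions). [folklore] -/
theorem isOpen_setOf_isIntegralMatrix :
    IsOpen {X : Matrix (Fin n) (Fin n) F | IsIntegralMatrix X} := by
  have e : {X : Matrix (Fin n) (Fin n) F | IsIntegralMatrix X} =
      ⋂ i, ⋂ j, (fun X : Matrix (Fin n) (Fin n) F => X i j) ⁻¹' (𝒪[F] : Set F) := by
    ext X; simp [IsIntegralMatrix]
  rw [e]
  exact isOpen_iInter_of_finite fun i => isOpen_iInter_of_finite fun j =>
    (Valuation.isOpen_integer (v := valuation F)).preimage (continuous_id.matrix_elem i j)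

/-- **Uniform local constancy of Schwartz–Bruhat functions on `M_n(F)`.** For `Φ ∈ 𝒮(M_n(F))`
and a uniformizing element `ϖ` there is `N` with `Φ(x + ϖ^N y) = Φ(x)` for all `x ∈ M_n(F)` and
all integral `y`: around each point `Φ` is constant on a box `x + ϖ^{N_x} M_n(𝒪)`
(`exists_forall_valuation_le_mem`), finitely many boxes cover the compact support, and boxes are
cosets of additive subgroups. [folklore] -/
theorem exists_forall_add_smul_eq_of_mem_schwartzBruhat {ϖ : F} (hϖ : IsUniformizingElement ϖ)
    {Φ : Matrix (Fin n) (Fin n) F → ℂ} (hΦ : Φ ∈ SchwartzBruhat (Matrix (Fin n) (Fin n) F)) :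
    ∃ N : ℕ, ∀ x y : Matrix (Fin n) (Fin n) F, IsIntegralMatrix y → Φ (x + ϖ ^ N • y) = Φ x := by
  classical
  have hϖ0 : ϖ ≠ 0 := hϖ.ne_zero
  -- around each `x`, a level `N x` such that `Φ` is constant on `x + ϖ^{N x} M_n(𝒪)`
  have hloc : ∀ x : Matrix (Fin n) (Fin n) F, ∃ N : ℕ, ∀ x' : Matrix (Fin n) (Fin n) F,
      IsIntegralMatrix ((ϖ ^ N)⁻¹ • (x' - x)) → Φ x' = Φ x := by
    intro x
    have hO : Φ ⁻¹' {Φ x} ∈ 𝓝 x := (hΦ.1.isOpen_fiber (Φ x)).mem_nhds rfl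
    obtain ⟨s, hs, h⟩ := exists_forall_valuation_le_mem hO
    obtain ⟨N, hN⟩ := exists_pow_mul_mem hϖ s⁻¹
    refine ⟨N, fun x' hx' => h x' fun i j => ?_⟩
    have h1 : (ϖ ^ N)⁻¹ * (x' i j - x i j) ∈ 𝒪[F] := by
      have := hx' i j
      rwa [Matrix.smul_apply, smul_eq_mul, Matrix.sub_apply] at this
    have h2 : ϖ ^ N * s⁻¹ ∈ 𝒪[F] := hN N le_rfl
    have h3 : (x' i j - x i j) * s⁻¹ ∈ 𝒪[F] := by
      have : (x' i j - x i j) * s⁻¹ = ((ϖ ^ N)⁻¹ * (x' i j - x i j)) * (ϖ ^ N * s⁻¹) := by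
        field_simp
      rw [this]; exact mul_mem h1 h2
    have h4 : valuation F ((x' i j - x i j) * s⁻¹) ≤ 1 := (Valuation.mem_integer_iff _ _).mp h3
    rw [map_mul, map_inv₀] at h4
    have hvs : valuation F s ≠ 0 := (Valuation.ne_zero_iff _).mpr hs
    rwa [mul_inv_le_iff₀ (zero_lt_iff.mpr hvs), one_mul] at h4
  choose N hN using hloc
  -- the boxes
  set B : Matrix (Fin n) (Fin n) F → Set (Matrix (Fin n) (Fin n) F) := fun x =>
    {x' | IsIntegralMatrix ((ϖ ^ N x)⁻¹ • (x' - x))} with hB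
  have hBopen : ∀ x, IsOpen (B x) := fun x =>
    isOpen_setOf_isIntegralMatrix.preimage
      ((continuous_id.sub continuous_const).const_smul ((ϖ ^ N x)⁻¹) :
        Continuous fun x' : Matrix (Fin n) (Fin n) F => (ϖ ^ N x)⁻¹ • (x' - x))
  have hBself : ∀ x, x ∈ B x := fun x => by
    change IsIntegralMatrix ((ϖ ^ N x)⁻¹ • (x - x))
    rw [sub_self, smul_zero]; exact IsIntegralMatrix.zero
  have hcover : tsupport Φ ⊆ ⋃ x, B x := fun x _ => Set.mem_iUnion.mpr ⟨x, hBself x⟩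
  obtain ⟨T, hT⟩ := hΦ.2.elim_finite_subcover B hBopen hcover
  -- the uniform level
  refine ⟨T.sup N, fun x y hy => ?_⟩
  -- boxes of the cover are stable under `+ ϖ^(sup N) y`
  have hstab : ∀ t ∈ T, ∀ (x' y' : Matrix (Fin n) (Fin n) F), IsIntegralMatrix y' →
      x' ∈ B t → x' + ϖ ^ T.sup N • y' ∈ B t := by
    intro t ht x' y' hy' hx'
    have hle : N t ≤ T.sup N := Finset.le_sup ht
    change IsIntegralMatrix ((ϖ ^ N t)⁻¹ • (x' + ϖ ^ T.sup N • y' - t))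
    have e : (ϖ ^ N t)⁻¹ • (x' + ϖ ^ T.sup N • y' - t) =
        (ϖ ^ N t)⁻¹ • (x' - t) + ϖ ^ (T.sup N - N t) • y' := by
      rw [show x' + ϖ ^ T.sup N • y' - t = (x' - t) + ϖ ^ T.sup N • y' by abel, smul_add,
        smul_smul]
      congr 2
      rw [← zpow_natCast, ← zpow_natCast, ← _root_.zpow_neg, ← zpow_add₀ hϖ0, ← zpow_natCast,
        Nat.cast_sub hle]
      ring_nf
    rw [e]
    exact IsIntegralMatrix.add hx' (hy'.smul (hϖ.pow_mem _))
  have hval : ∀ t ∈ T, ∀ x', x' ∈ B t → Φ x' = Φ t := fun t _ x' hx' => hN t x' hx'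
  by_cases h1 : x ∈ tsupport Φ
  · obtain ⟨t, ht, hxt⟩ := Set.mem_iUnion₂.mp (hT h1)
    rw [hval t ht _ (hstab t ht x y hy hxt), hval t ht x hxt]
  · by_cases h2 : x + ϖ ^ T.sup N • y ∈ tsupport Φ
    · obtain ⟨t, ht, hxt⟩ := Set.mem_iUnion₂.mp (hT h2)
      have hx' : x ∈ B t := by
        have := hstab t ht _ (-y) hy.neg hxt
        rwa [smul_neg, ← sub_eq_add_neg, add_sub_cancel_right] at this
      rw [hval t ht _ hxt, hval t ht x hx']
    · rw [image_eq_zero_of_notMem_tsupport h1, image_eq_zero_of_notMem_tsupport h2]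

/-- **Schwartz–Bruhat functions on `M_n(F)` are bi-invariant under a principal congruence
subgroup**: for `Φ ∈ 𝒮(M_n(F))` there is `m ≥ 1` with `Φ(x k) = Φ(x) = Φ(k x)` for all
`x ∈ M_n(F)` and `k ∈ K_m = 1 + ϖ^m M_n(𝒪)` (`congruenceGL n |ϖ|^m`): with `supp Φ ⊆ ϖ^{-r} M_n(𝒪)`
and `Φ(x + ϖ^N y) = Φ(x)`, take `m = N + r + 1`. [folklore] -/
theorem exists_forall_mul_congruenceGL_eq_of_mem_schwartzBruhat {ϖ : F}
    (hϖ : IsUniformizingElement ϖ) {Φ : Matrix (Fin n) (Fin n) F → ℂ}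
    (hΦ : Φ ∈ SchwartzBruhat (Matrix (Fin n) (Fin n) F)) :
    ∃ m : ℕ, 1 ≤ m ∧ ∀ k ∈ congruenceGL n (valuation F ϖ ^ m), ∀ x : Matrix (Fin n) (Fin n) F,
      Φ (x * (k : Matrix (Fin n) (Fin n) F)) = Φ x ∧ Φ ((k : Matrix (Fin n) (Fin n) F) * x) = Φ x := by
  classical
  have hϖ0 : ϖ ≠ 0 := hϖ.ne_zero
  obtain ⟨r, hr⟩ := exists_isIntegralMatrix_smul_of_hasCompactSupport hϖ hΦ.2
  obtain ⟨N, hN⟩ := exists_forall_add_smul_eq_of_mem_schwartzBruhat hϖ hΦ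
  refine ⟨N + r + 1, by omega, fun k hk x => ?_⟩
  obtain ⟨X, hX, hkX⟩ := exists_eq_one_add_smul_of_mem_congruenceGL hϖ0 hk
  have hkK : k ∈ glInt n F := congruenceGL_le_glInt _ hk
  -- the two translates as `x + ϖ^N (integral)` when `ϖ^r x` is integral
  have epow : (ϖ ^ (N + r + 1) : F) = ϖ ^ N * (ϖ * ϖ ^ r) := by ring
  have hright : IsIntegralMatrix (ϖ ^ r • x) →
      x * (k : Matrix (Fin n) (Fin n) F) = x + ϖ ^ N • ((ϖ * ϖ ^ r) • (x * X)) := fun _ => by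
    rw [hkX, Matrix.mul_add, Matrix.mul_one, Matrix.mul_smul, smul_smul, ← epow]
  have hleft : IsIntegralMatrix (ϖ ^ r • x) →
      (k : Matrix (Fin n) (Fin n) F) * x = x + ϖ ^ N • ((ϖ * ϖ ^ r) • (X * x)) := fun _ => by
    rw [hkX, Matrix.add_mul, Matrix.one_mul, Matrix.smul_mul, smul_smul, ← epow]
  have hint₁ : IsIntegralMatrix (ϖ ^ r • x) → IsIntegralMatrix ((ϖ * ϖ ^ r) • (x * X)) := by
    intro h
    rw [← smul_smul, ← Matrix.smul_mul]
    exact (h.mul hX).smul hϖ.mem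
  have hint₂ : IsIntegralMatrix (ϖ ^ r • x) → IsIntegralMatrix ((ϖ * ϖ ^ r) • (X * x)) := by
    intro h
    rw [← smul_smul, ← Matrix.mul_smul]
    exact (hX.mul h).smul hϖ.mem
  by_cases hx : IsIntegralMatrix (ϖ ^ r • x)
  · exact ⟨by rw [hright hx, hN _ _ (hint₁ hx)], by rw [hleft hx, hN _ _ (hint₂ hx)]⟩
  · -- off `ϖ^{-r} M_n(𝒪)` everything vanishes
    have h0 : Φ x = 0 := by by_contra h; exact hx (hr x h)
    have hk' : IsIntegralMatrix ((k⁻¹ : GL (Fin n) F) : Matrix (Fin n) (Fin n) F) :=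
      isIntegralMatrix_inv_of_mem_glInt hkK
    refine ⟨?_, ?_⟩
    · rw [h0]
      by_contra h
      have h1 := hr _ h
      rw [← Matrix.smul_mul] at h1
      have h2 := h1.mul hk'
      rw [Matrix.mul_assoc, ← Units.val_mul, mul_inv_cancel, Units.val_one, Matrix.mul_one] at h2
      exact hx h2
    · rw [h0]
      by_contra h
      have h1 := hr _ h
      rw [← Matrix.mul_smul] at h1
      have h2 := hk'.mul h1
      rw [← Matrix.mul_assoc, ← Units.val_mul, inv_mul_cancel, Units.val_one, Matrix.one_mul] at h2
      exact hx h2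

end LocallyConstant

/-! ### The lattice expansion of right-`GL_n(𝒪)`-invariant Schwartz–Bruhat functions -/

section LatticeSpan

variable {F : Type*} [Field F] [ValuativeRel F] {n : ℕ} {ϖ : F}

/-- For a uniformizing element, `ϖ^d ∈ 𝒪` iff `d ≥ 0` (`ϖ⁻¹ ∉ 𝒪`). [folklore] -/
theorem IsUniformizingElement.zpow_mem_iff (hϖ : IsUniformizingElement ϖ) {d : ℤ} :
    ϖ ^ d ∈ 𝒪[F] ↔ 0 ≤ d := by
  refine ⟨fun h => ?_, hϖ.zpow_mem⟩
  by_contra hd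
  push Not at hd
  have e : ϖ⁻¹ = ϖ ^ d * ϖ ^ (-d - 1) := by
    rw [← zpow_add₀ hϖ.ne_zero, show d + (-d - 1) = -1 by ring, _root_.zpow_neg_one]
  exact hϖ.inv_not_mem (e ▸ mul_mem h (hϖ.zpow_mem (by omega)))

/-- `ϖ^a = diag(ϖ^{a_i})` is an integral matrix iff all `a_i ≥ 0`. [folklore] -/
theorem isIntegralMatrix_coe_zpowDiagGL_iff (hϖ : IsUniformizingElement ϖ) (a : Fin n → ℤ) :
    IsIntegralMatrix ((zpowDiagGL hϖ.ne_zero a : GL (Fin n) F) : Matrix (Fin n) (Fin n) F) ↔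
      ∀ i, 0 ≤ a i := by
  rw [coe_zpowDiagGL]
  refine ⟨fun h i => ?_, fun h => isIntegralMatrix_diagonal fun i => hϖ.zpow_mem (h i)⟩
  have := h i i
  rw [Matrix.diagonal_apply_eq] at this
  exact hϖ.zpow_mem_iff.mp this

variable [TopologicalSpace F] [IsNonarchimedeanLocalField F]

/-- **The truncated Cartan normal form.** Let `ϖ^N x` be integral (`x ∈ GL_n(F)`) and write
`x = k₁⁻¹ ϖ^a k₂⁻¹` (Cartan decomposition). Then `y = k₁⁻¹ ϖ^{min(a, N)}` — a basis matrix of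
the lattice `x 𝒪ⁿ + ϖ^N 𝒪ⁿ` — satisfies: `ϖ^N y ∈ Δ_m` for some `m ≤ 2nN`, `ϖ^N y⁻¹` is
integral, `z⁻¹ x` is integral iff `z⁻¹ y` is for every `z` with `ϖ^N z⁻¹` integral, and
`Φ(x) = Φ(y)` for every right-`GL_n(𝒪)`-invariant `Φ` with `Φ(X + ϖ^N Y) = Φ(X)` (`Y` integral),
as `y ≡ k₁⁻¹ ϖ^a = x k₂ (mod ϖ^N M_n(𝒪))`. [folklore] -/
theorem exists_truncation_of_isIntegralMatrix (hϖ : IsUniformizingElement ϖ) (N : ℕ)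
    {x : GL (Fin n) F}
    (hx : IsIntegralMatrix ((zpowDiagGL hϖ.ne_zero (fun _ : Fin n => (N : ℤ)) * x :
      GL (Fin n) F) : Matrix (Fin n) (Fin n) F)) :
    ∃ y : GL (Fin n) F,
      (∃ m : ℕ, m ≤ 2 * n * N ∧
        zpowDiagGL hϖ.ne_zero (fun _ : Fin n => (N : ℤ)) * y ∈ glIntDet n ϖ m) ∧
      IsIntegralMatrix ((zpowDiagGL hϖ.ne_zero (fun _ : Fin n => (N : ℤ)) * y⁻¹ :
        GL (Fin n) F) : Matrix (Fin n) (Fin n) F) ∧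
      (∀ z : GL (Fin n) F, IsIntegralMatrix ((zpowDiagGL hϖ.ne_zero (fun _ : Fin n => (N : ℤ)) *
          z⁻¹ : GL (Fin n) F) : Matrix (Fin n) (Fin n) F) →
        (IsIntegralMatrix ((z⁻¹ * x : GL (Fin n) F) : Matrix (Fin n) (Fin n) F) ↔
          IsIntegralMatrix ((z⁻¹ * y : GL (Fin n) F) : Matrix (Fin n) (Fin n) F))) ∧
      ∀ Φ : Matrix (Fin n) (Fin n) F → ℂ,
        (∀ k ∈ glInt n F, ∀ X : Matrix (Fin n) (Fin n) F,
          Φ (X * (k : Matrix (Fin n) (Fin n) F)) = Φ X) →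
        (∀ X Y : Matrix (Fin n) (Fin n) F, IsIntegralMatrix Y → Φ (X + ϖ ^ N • Y) = Φ X) →
        Φ (x : Matrix (Fin n) (Fin n) F) = Φ (y : Matrix (Fin n) (Fin n) F) := by
  classical
  have hϖ0 : ϖ ≠ 0 := hϖ.ne_zero
  set zN : GL (Fin n) F := zpowDiagGL hϖ0 (fun _ : Fin n => (N : ℤ)) with hzNdef
  have hcomm : ∀ g : GL (Fin n) F, g * zN = zN * g := fun g => mul_zpowDiagGL_const_comm hϖ0 _ g
  have hzN_coe : (zN : Matrix (Fin n) (Fin n) F) = ϖ ^ N • (1 : Matrix (Fin n) (Fin n) F) := by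
    rw [hzNdef, coe_zpowDiagGL_const, zpow_natCast, Matrix.smul_one_eq_diagonal]; rfl
  have hzN_mul : ∀ X : Matrix (Fin n) (Fin n) F, (zN : Matrix (Fin n) (Fin n) F) * X = ϖ ^ N • X :=
    fun X => by rw [hzN_coe, Matrix.smul_mul, Matrix.one_mul]
  -- Cartan decomposition `k₁ x k₂ = ϖ^a`
  obtain ⟨k₁, hk₁, k₂, hk₂, a, -, hcartan⟩ := exists_glInt_mul_mul_eq_zpowDiagGL hϖ x
  have hxeq : x = k₁⁻¹ * zpowDiagGL hϖ0 a * k₂⁻¹ := by rw [← hcartan]; group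
  -- `a_i + N ≥ 0`
  have ha : ∀ i, 0 ≤ a i + N := by
    have h1 : IsIntegralMatrix ((zN * zpowDiagGL hϖ0 a : GL (Fin n) F) : Matrix (Fin n) (Fin n) F) := by
      have e : zN * zpowDiagGL hϖ0 a = k₁ * (zN * x) * k₂ := by
        rw [← hcartan, ← mul_assoc k₁ zN x, hcomm k₁]; group
      rw [e, isIntegralMatrix_mul_glInt_iff hk₂, Units.val_mul]
      exact (isIntegralMatrix_glInt_mul_iff hk₁ _).mpr hx
    rw [hzNdef, ← zpowDiagGL_add] at h1
    have h2 := (isIntegralMatrix_coe_zpowDiagGL_iff hϖ _).mp h1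
    intro i
    have := h2 i
    simp only [Pi.add_apply] at this
    omega
  -- the truncated exponents and `y`
  set b : Fin n → ℤ := fun i => min (a i) N with hbdef
  have hb_le_a : ∀ i, b i ≤ a i := fun i => min_le_left _ _
  have hb_le_N : ∀ i, b i ≤ N := fun i => min_le_right _ _
  have hbN : ∀ i, 0 ≤ b i + N := fun i => by
    simp only [hbdef]; rcases le_total (a i) N with h | h
    · rw [min_eq_left h]; exact ha i
    · rw [min_eq_right h]; omega
  set y : GL (Fin n) F := k₁⁻¹ * zpowDiagGL hϖ0 b with hydef
  refine ⟨y, ?_, ?_, ?_, ?_⟩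
  · -- `ϖ^N y ∈ Δ_m`, `m = ∑ (b_i + N) ≤ 2 n N`
    set c : Fin n → ℕ := fun i => (b i + N).toNat with hcdef
    refine ⟨∑ i, c i, ?_, ?_⟩
    · calc ∑ i, c i ≤ ∑ _i : Fin n, 2 * N := Finset.sum_le_sum fun i _ => by
            simp only [hcdef]
            have := hb_le_N i
            omega
        _ = 2 * n * N := by rw [Finset.sum_const, Finset.card_univ, Fintype.card_fin, smul_eq_mul]; ring
    · have e : zN * y = k₁⁻¹ * piPowGL hϖ0 c := by
        have hfun : (fun i => ((c i : ℕ) : ℤ)) = (fun _ : Fin n => (N : ℤ)) + b := by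
          funext i
          simp only [Pi.add_apply, hcdef]
          rw [Int.toNat_of_nonneg (hbN i), add_comm]
        rw [hydef, ← mul_assoc, ← hcomm, mul_assoc, hzNdef, ← zpowDiagGL_add, ← zpowDiagGL_natCast,
          hfun]
      rw [e, glInt_mul_mem_glIntDet_iff (inv_mem hk₁)]
      exact piPowGL_mem_glIntDet hϖ c
  · -- `ϖ^N y⁻¹` is integral
    have e : zN * y⁻¹ = zpowDiagGL hϖ0 (fun i => (N : ℤ) - b i) * k₁ := by
      have hfun : (fun i => (N : ℤ) - b i) = (fun _ : Fin n => (N : ℤ)) + -b := by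
        funext i; simp only [Pi.add_apply, Pi.neg_apply]; ring
      rw [hydef, _root_.mul_inv_rev, inv_inv, ← zpowDiagGL_neg, ← mul_assoc, hzNdef,
        ← zpowDiagGL_add, hfun]
    rw [e, isIntegralMatrix_mul_glInt_iff hk₁, isIntegralMatrix_coe_zpowDiagGL_iff hϖ]
    intro i
    have := hb_le_N i
    omega
  · -- `z⁻¹ x` integral iff `z⁻¹ y` integral
    intro z hz
    -- `y⁻¹ x = ϖ^{a - b} k₂⁻¹` is integral
    have hyx : IsIntegralMatrix ((y⁻¹ * x : GL (Fin n) F) : Matrix (Fin n) (Fin n) F) := by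
      have e : y⁻¹ * x = zpowDiagGL hϖ0 (fun i => a i - b i) * k₂⁻¹ := by
        have hfun : (fun i => a i - b i) = -b + a := by
          funext i; simp only [Pi.add_apply, Pi.neg_apply]; ring
        rw [hydef, hxeq, _root_.mul_inv_rev, inv_inv, ← zpowDiagGL_neg]
        rw [show zpowDiagGL hϖ0 (-b) * k₁ * (k₁⁻¹ * zpowDiagGL hϖ0 a * k₂⁻¹) =
          zpowDiagGL hϖ0 (-b) * zpowDiagGL hϖ0 a * k₂⁻¹ by group, ← zpowDiagGL_add, hfun]
      rw [e, isIntegralMatrix_mul_glInt_iff (inv_mem hk₂), isIntegralMatrix_coe_zpowDiagGL_iff hϖ]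
      intro i
      have := hb_le_a i
      omega
    refine ⟨fun h => ?_, fun h => ?_⟩
    · -- `z⁻¹ y = (z⁻¹ x)(k₂ D₁) + (ϖ^N z⁻¹)(k₁⁻¹ D₂)`
      set D₁ : Matrix (Fin n) (Fin n) F := Matrix.diagonal fun i => if a i ≤ N then 1 else 0
        with hD₁
      set D₂ : Matrix (Fin n) (Fin n) F := Matrix.diagonal fun i => if a i ≤ N then 0 else 1
        with hD₂
      have hD₁int : IsIntegralMatrix D₁ := isIntegralMatrix_diagonal fun i => by
        split_ifs; exacts [one_mem _, zero_mem _]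
      have hD₂int : IsIntegralMatrix D₂ := isIntegralMatrix_diagonal fun i => by
        split_ifs; exacts [zero_mem _, one_mem _]
      have hdiag : ((zpowDiagGL hϖ0 b : GL (Fin n) F) : Matrix (Fin n) (Fin n) F) =
          ((zpowDiagGL hϖ0 a : GL (Fin n) F) : Matrix (Fin n) (Fin n) F) * D₁ +
            ϖ ^ N • D₂ := by
        rw [coe_zpowDiagGL, coe_zpowDiagGL, hD₁, hD₂, Matrix.diagonal_mul_diagonal,
          Matrix.smul_eq_diagonal_mul, Matrix.diagonal_mul_diagonal, Matrix.diagonal_add]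
        congr 1
        funext i
        simp only [hbdef]
        split_ifs with h
        · rw [min_eq_left h]; ring
        · push Not at h
          rw [min_eq_right h.le, zpow_natCast]; ring
      have hxk : x * k₂ = k₁⁻¹ * zpowDiagGL hϖ0 a := by rw [hxeq]; group
      have ey : (y : Matrix (Fin n) (Fin n) F) =
          ((x : GL (Fin n) F) : Matrix (Fin n) (Fin n) F) *
              (((k₂ : GL (Fin n) F) : Matrix (Fin n) (Fin n) F) * D₁) +
            ((zN * k₁⁻¹ : GL (Fin n) F) : Matrix (Fin n) (Fin n) F) * D₂ := by
        have l : (y : Matrix (Fin n) (Fin n) F) =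
            (((k₁⁻¹ : GL (Fin n) F)) : Matrix (Fin n) (Fin n) F) *
                ((zpowDiagGL hϖ0 a : GL (Fin n) F) : Matrix (Fin n) (Fin n) F) * D₁ +
              ϖ ^ N • ((((k₁⁻¹ : GL (Fin n) F)) : Matrix (Fin n) (Fin n) F) * D₂) := by
          rw [hydef, Units.val_mul, hdiag, Matrix.mul_add, Matrix.mul_smul, ← Matrix.mul_assoc]
        have r1 : ((x : GL (Fin n) F) : Matrix (Fin n) (Fin n) F) *
            (((k₂ : GL (Fin n) F) : Matrix (Fin n) (Fin n) F) * D₁) =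
            (((k₁⁻¹ : GL (Fin n) F)) : Matrix (Fin n) (Fin n) F) *
              ((zpowDiagGL hϖ0 a : GL (Fin n) F) : Matrix (Fin n) (Fin n) F) * D₁ := by
          rw [← Matrix.mul_assoc, ← Units.val_mul, hxk, Units.val_mul]
        have r2 : ((zN * k₁⁻¹ : GL (Fin n) F) : Matrix (Fin n) (Fin n) F) * D₂ =
            ϖ ^ N • ((((k₁⁻¹ : GL (Fin n) F)) : Matrix (Fin n) (Fin n) F) * D₂) := by
          rw [Units.val_mul, hzN_mul, Matrix.smul_mul]
        rw [l, r1, r2]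
      have e : ((z⁻¹ * y : GL (Fin n) F) : Matrix (Fin n) (Fin n) F) =
          ((z⁻¹ * x : GL (Fin n) F) : Matrix (Fin n) (Fin n) F) *
              (((k₂ : GL (Fin n) F) : Matrix (Fin n) (Fin n) F) * D₁) +
            ((zN * z⁻¹ : GL (Fin n) F) : Matrix (Fin n) (Fin n) F) *
              ((((k₁⁻¹ : GL (Fin n) F)) : Matrix (Fin n) (Fin n) F) * D₂) := by
        have hc' : ((zN : GL (Fin n) F) : Matrix (Fin n) (Fin n) F) *
            (((z⁻¹ : GL (Fin n) F)) : Matrix (Fin n) (Fin n) F) =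
            (((z⁻¹ : GL (Fin n) F)) : Matrix (Fin n) (Fin n) F) * (zN : Matrix (Fin n) (Fin n) F) := by
          rw [← Units.val_mul, ← Units.val_mul, hcomm]
        rw [Units.val_mul, ey, Matrix.mul_add]
        simp only [Units.val_mul]
        rw [hc']
        simp only [Matrix.mul_assoc]
      rw [e]
      exact (h.mul ((isIntegralMatrix_of_mem_glInt hk₂).mul hD₁int)).add
        (hz.mul ((isIntegralMatrix_inv_of_mem_glInt hk₁).mul hD₂int))
    · have e : z⁻¹ * x = (z⁻¹ * y) * (y⁻¹ * x) := by group
      rw [e, Units.val_mul]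
      exact h.mul hyx
  · -- `Φ(x) = Φ(x k₂) = Φ(k₁⁻¹ ϖ^a) = Φ(y)`
    intro Φ hK hT
    have h1 : Φ (x : Matrix (Fin n) (Fin n) F) =
        Φ ((k₁⁻¹ * zpowDiagGL hϖ0 a : GL (Fin n) F) : Matrix (Fin n) (Fin n) F) := by
      rw [← hK k₂ hk₂ (x : Matrix (Fin n) (Fin n) F), ← Units.val_mul, hxeq, inv_mul_cancel_right]
    -- `y = k₁⁻¹ ϖ^a + ϖ^N W`, `W = k₁⁻¹ diag(ϖ^{b_i - N} - ϖ^{a_i - N})` integral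
    set w : Fin n → F := fun i => ϖ ^ (b i - N) - ϖ ^ (a i - N) with hwdef
    have hw : ∀ i, w i ∈ 𝒪[F] := by
      intro i
      simp only [hwdef, hbdef]
      rcases le_or_gt (a i) N with h | h
      · rw [min_eq_left h, sub_self]; exact zero_mem _
      · rw [min_eq_right h.le, sub_self, zpow_zero]
        exact sub_mem (one_mem _) (hϖ.zpow_mem (by omega))
    have e : (y : Matrix (Fin n) (Fin n) F) =
        ((k₁⁻¹ * zpowDiagGL hϖ0 a : GL (Fin n) F) : Matrix (Fin n) (Fin n) F) +
          ϖ ^ N • ((((k₁⁻¹ : GL (Fin n) F)) : Matrix (Fin n) (Fin n) F) * Matrix.diagonal w) := by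
      rw [hydef, Units.val_mul, Units.val_mul, ← Matrix.mul_smul, ← Matrix.mul_add, coe_zpowDiagGL,
        coe_zpowDiagGL, Matrix.smul_eq_diagonal_mul, Matrix.diagonal_mul_diagonal,
        Matrix.diagonal_add]
      congr 2
      funext i
      simp only [hwdef, mul_sub]
      rw [← zpow_natCast, ← zpow_add₀ hϖ0, ← zpow_add₀ hϖ0]
      ring_nf
    rw [h1, e, hT _ _ ((isIntegralMatrix_inv_of_mem_glInt hk₁).mul (isIntegralMatrix_diagonal hw))]

/-- **The lattice expansion of right-`GL_n(𝒪)`-invariant Schwartz–Bruhat functions.** If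
`Φ ∈ 𝒮(M_n(F))` satisfies `Φ(x k) = Φ(x)` for all `k ∈ GL_n(𝒪)`, there are finitely many
`c_i ∈ ℂ` and `z_i ∈ GL_n(F)` with `Φ(x) = ∑_i c_i · 1_{M_n(𝒪)}(z_i⁻¹ x)` for every
**invertible** `x` (Möbius inversion on the finite poset of the lattices `L` with
`ϖ^N 𝒪ⁿ ⊆ L ⊆ ϖ^{-N} 𝒪ⁿ`, see the module docstring). [folklore] -/
theorem exists_eq_sum_indicator_intMatrices_of_mem_schwartzBruhat
    {Φ : Matrix (Fin n) (Fin n) F → ℂ} (hΦ : Φ ∈ SchwartzBruhat (Matrix (Fin n) (Fin n) F))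
    (hK : ∀ k ∈ glInt n F, ∀ x : Matrix (Fin n) (Fin n) F,
      Φ (x * (k : Matrix (Fin n) (Fin n) F)) = Φ x) :
    ∃ (m : ℕ) (c : Fin m → ℂ) (z : Fin m → GL (Fin n) F), ∀ x : GL (Fin n) F,
      Φ x = ∑ i, c i * (intMatrices n F).indicator 1
        ((((z i)⁻¹ * x : GL (Fin n) F)) : Matrix (Fin n) (Fin n) F) := by
  classical
  obtain ⟨ϖ, hϖ⟩ := exists_isUniformizingElement (F := F)
  have hϖ0 : ϖ ≠ 0 := hϖ.ne_zero
  -- a common level `N`: support in `ϖ^{-N} M_n(𝒪)` and invariance under `ϖ^N M_n(𝒪)`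
  obtain ⟨r, hr⟩ := exists_isIntegralMatrix_smul_of_hasCompactSupport hϖ hΦ.2
  obtain ⟨N₀, hN₀⟩ := exists_forall_add_smul_eq_of_mem_schwartzBruhat hϖ hΦ
  set N : ℕ := max r N₀ with hNdef
  have hS : ∀ x : Matrix (Fin n) (Fin n) F, Φ x ≠ 0 → IsIntegralMatrix (ϖ ^ N • x) := by
    intro x hx
    have e : ϖ ^ N • x = ϖ ^ (N - r) • (ϖ ^ r • x) := by
      rw [smul_smul, ← pow_add, Nat.sub_add_cancel (le_max_left _ _)]
    rw [e]
    exact (hr x hx).smul (hϖ.pow_mem _)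
  have hT : ∀ x y : Matrix (Fin n) (Fin n) F, IsIntegralMatrix y → Φ (x + ϖ ^ N • y) = Φ x := by
    intro x y hy
    have e : ϖ ^ N • y = ϖ ^ N₀ • (ϖ ^ (N - N₀) • y) := by
      rw [smul_smul, ← pow_add, Nat.add_sub_cancel' (le_max_right _ _)]
    rw [e]
    exact hN₀ x _ (hy.smul (hϖ.pow_mem _))
  -- the central element `ϖ^N`
  set zN : GL (Fin n) F := zpowDiagGL hϖ0 (fun _ : Fin n => (N : ℤ)) with hzNdef
  have hcomm : ∀ g : GL (Fin n) F, g * zN = zN * g := fun g => mul_zpowDiagGL_const_comm hϖ0 _ g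
  have hzNx : ∀ x : GL (Fin n) F, IsIntegralMatrix ((zN * x : GL (Fin n) F) : Matrix (Fin n) (Fin n) F) ↔
      IsIntegralMatrix (ϖ ^ N • (x : Matrix (Fin n) (Fin n) F)) :=
    fun x => isIntegralMatrix_zpowDiagGL_const_mul_iff hϖ0 N x
  -- the finite index set of cosets
  set S : Set (GL (Fin n) F ⧸ glInt n F) := {γ |
    (∃ m : ℕ, m ≤ 2 * n * N ∧ zN * γ.out ∈ glIntDet n ϖ m) ∧
      IsIntegralMatrix ((zN * γ.out⁻¹ : GL (Fin n) F) : Matrix (Fin n) (Fin n) F)} with hSdef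
  have hSfin : S.Finite := by
    refine Set.Finite.subset (Set.Finite.biUnion (Finset.range (2 * n * N + 1)).finite_toSet
      fun m _ => (finite_cosets_glIntDet (n := n) hϖ m).preimage
        (Set.injOn_of_injective (MulAction.injective zN))) ?_
    rintro γ ⟨⟨m, hm, hγ⟩, -⟩
    refine Set.mem_iUnion₂.mpr ⟨m, Finset.mem_coe.mpr (Finset.mem_range.mpr (by omega)), ?_⟩
    change (zN • γ).out ∈ glIntDet n ϖ m
    exact (smul_out_mem_glIntDet_iff' zN γ).mpr hγ
  haveI : Finite S := hSfin.to_subtype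
  haveI : Fintype S := Fintype.ofFinite S
  -- the partial order `γ ≼ γ' ↔ γ'⁻¹ γ` integral, and Möbius inversion for `γ ↦ Φ(γ)`
  set rel : S → S → Prop := fun γ γ' =>
    IsIntegralMatrix ((((γ' : GL (Fin n) F ⧸ glInt n F).out)⁻¹ * (γ : GL (Fin n) F ⧸ glInt n F).out :
      GL (Fin n) F) : Matrix (Fin n) (Fin n) F) with hrel
  have hrefl : ∀ γ, rel γ γ := fun γ => by
    simp only [hrel, inv_mul_cancel, Units.val_one]; exact IsIntegralMatrix.one
  have htrans : ∀ γ γ' γ'', rel γ γ' → rel γ' γ'' → rel γ γ'' := by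
    intro γ γ' γ'' h h'
    have e : ((γ'' : GL (Fin n) F ⧸ glInt n F).out)⁻¹ * (γ : GL (Fin n) F ⧸ glInt n F).out =
        (((γ'' : GL (Fin n) F ⧸ glInt n F).out)⁻¹ * (γ' : GL (Fin n) F ⧸ glInt n F).out) *
          (((γ' : GL (Fin n) F ⧸ glInt n F).out)⁻¹ * (γ : GL (Fin n) F ⧸ glInt n F).out) := by group
    simp only [hrel] at h h' ⊢
    rw [e, Units.val_mul]
    exact h'.mul h
  have hanti : ∀ γ γ', rel γ γ' → rel γ' γ → γ = γ' := by
    intro γ γ' h h'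
    simp only [hrel] at h h'
    have hmem : ((γ' : GL (Fin n) F ⧸ glInt n F).out)⁻¹ * (γ : GL (Fin n) F ⧸ glInt n F).out ∈
        glInt n F := by
      refine (mem_glInt_iff _).mpr ⟨h, ?_⟩
      rw [_root_.mul_inv_rev, inv_inv]
      exact h'
    apply Subtype.ext
    rw [← QuotientGroup.out_eq' (γ : GL (Fin n) F ⧸ glInt n F),
      ← QuotientGroup.out_eq' (γ' : GL (Fin n) F ⧸ glInt n F), eq_comm]
    exact QuotientGroup.eq.mpr hmem
  obtain ⟨m, hm⟩ := exists_eq_sum_mul_ite_of_rel rel hrefl htrans hanti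
    (fun γ => Φ (((γ : GL (Fin n) F ⧸ glInt n F).out : GL (Fin n) F) : Matrix (Fin n) (Fin n) F))
  -- the indicator `1_M(w)` as an `if`
  have hind : ∀ w : GL (Fin n) F, (intMatrices n F).indicator (1 : Matrix (Fin n) (Fin n) F → ℂ)
      (w : Matrix (Fin n) (Fin n) F) =
      if IsIntegralMatrix (w : Matrix (Fin n) (Fin n) F) then 1 else 0 := by
    intro w
    by_cases hw : IsIntegralMatrix (w : Matrix (Fin n) (Fin n) F)
    · rw [if_pos hw, Set.indicator_of_mem ((mem_intMatrices_iff _).mpr hw), Pi.one_apply]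
    · rw [if_neg hw, Set.indicator_of_notMem (fun h => hw ((mem_intMatrices_iff _).mp h))]
  -- reindex by `Fin`
  set e := Fintype.equivFin S with hedef
  refine ⟨Fintype.card S, fun i => m (e.symm i),
    fun i => ((e.symm i : S) : GL (Fin n) F ⧸ glInt n F).out, fun x => ?_⟩
  change Φ (x : Matrix (Fin n) (Fin n) F) = ∑ i, m (e.symm i) * (intMatrices n F).indicator 1
    ((((((e.symm i : S) : GL (Fin n) F ⧸ glInt n F).out)⁻¹ * x : GL (Fin n) F)) :
      Matrix (Fin n) (Fin n) F)
  rw [e.symm.sum_comp (fun p : S => m p * (intMatrices n F).indicator 1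
    ((((((p : S) : GL (Fin n) F ⧸ glInt n F).out)⁻¹ * x : GL (Fin n) F)) : Matrix (Fin n) (Fin n) F))]
  simp_rw [hind]
  by_cases hx : IsIntegralMatrix ((zN * x : GL (Fin n) F) : Matrix (Fin n) (Fin n) F)
  · -- `x ∈ ϖ^{-N} M_n(𝒪)`: pass to the truncated Cartan normal form `y`
    obtain ⟨y, ⟨my, hmy, hy1⟩, hy2, hy3, hy4⟩ := exists_truncation_of_isIntegralMatrix hϖ N hx
    obtain ⟨κ, hκ⟩ := QuotientGroup.mk_out_eq_mul (glInt n F) y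
    have hyS : (y : GL (Fin n) F ⧸ glInt n F) ∈ S := by
      refine ⟨⟨my, hmy, ?_⟩, ?_⟩
      · rw [hκ, ← mul_assoc, mul_glInt_mem_glIntDet_iff κ.2]; exact hy1
      · rw [hκ, _root_.mul_inv_rev, ← mul_assoc, show zN * ((κ : GL (Fin n) F))⁻¹ =
          ((κ : GL (Fin n) F))⁻¹ * zN from (hcomm _).symm, mul_assoc, Units.val_mul]
        exact (isIntegralMatrix_glInt_mul_iff (inv_mem κ.2) _).mpr hy2
    set p₀ : S := ⟨(y : GL (Fin n) F ⧸ glInt n F), hyS⟩ with hp₀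
    have hΦx : Φ (x : Matrix (Fin n) (Fin n) F) =
        Φ ((((p₀ : GL (Fin n) F ⧸ glInt n F).out : GL (Fin n) F)) : Matrix (Fin n) (Fin n) F) := by
      rw [hy4 Φ hK hT]
      change Φ (y : Matrix (Fin n) (Fin n) F) =
        Φ ((((y : GL (Fin n) F ⧸ glInt n F).out : GL (Fin n) F)) : Matrix (Fin n) (Fin n) F)
      rw [hκ, Units.val_mul, hK _ κ.2]
    rw [hΦx, hm p₀]
    refine Finset.sum_congr rfl fun p _ => ?_
    congr 1
    have hp : IsIntegralMatrix ((zN * ((p : GL (Fin n) F ⧸ glInt n F).out)⁻¹ : GL (Fin n) F) :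
        Matrix (Fin n) (Fin n) F) := p.2.2
    have hiff : rel p₀ p ↔
        IsIntegralMatrix (((((p : GL (Fin n) F ⧸ glInt n F).out)⁻¹ * x : GL (Fin n) F)) :
          Matrix (Fin n) (Fin n) F) := by
      simp only [hrel]
      change IsIntegralMatrix ((((p : GL (Fin n) F ⧸ glInt n F).out)⁻¹ *
        ((y : GL (Fin n) F ⧸ glInt n F).out) : GL (Fin n) F) : Matrix (Fin n) (Fin n) F) ↔ _
      rw [hκ, ← mul_assoc, isIntegralMatrix_mul_glInt_iff κ.2, hy3 _ hp]
    by_cases h : rel p₀ p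
    · rw [if_pos h, if_pos (hiff.mp h)]
    · rw [if_neg h, if_neg (fun h' => h (hiff.mpr h'))]
  · -- off `ϖ^{-N} M_n(𝒪)` both sides vanish
    have h0 : Φ (x : Matrix (Fin n) (Fin n) F) = 0 := by
      by_contra h
      exact hx ((hzNx x).mpr (hS _ h))
    rw [h0, eq_comm]
    refine Finset.sum_eq_zero fun p _ => ?_
    rw [if_neg, mul_zero]
    intro h
    apply hx
    obtain ⟨⟨mp, -, hp1⟩, -⟩ := p.2
    have e : zN * x = (zN * (p : GL (Fin n) F ⧸ glInt n F).out) *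
        (((p : GL (Fin n) F ⧸ glInt n F).out)⁻¹ * x) := by group
    rw [e, Units.val_mul]
    exact (mem_glIntDet_iff.mp hp1).1.mul h

end LatticeSpan

end Literature.NumberTheory.Automorphic
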